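import Mathlib
import Literature.MathematicalPhysics.QuantumFieldTheory.Balaban1983to89.B5Eq120IterProof
import Literature.MathematicalPhysics.QuantumFieldTheory.TorusChartFlatCochains

/-!
# `Balaban1983to89.B5Positivity172Lattice` — T. Bałaban, *Propagators and renormalization transformations for lattice gauge
theories. I*, Commun. Math. Phys. **95** (1984) 17–40 [Balaban1984PropagatorsI] ("B5" / [6I]): the two KERNEL statements of
Sect. C–D on the torus, for the V1 lattice calculus `LatticeFieldCalculus` — p. 22/25 «Δ is positive definite on N(Q′_k), thus
invertible» (qualitative content: `Q′_kλ = 0 ∧ Δλ = 0 ⇒ λ = 0`) and the zero-mode argument of p. 30 after (1.72) («QA = ∂₁ω + A₀ = 0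
… implies ω = 0 … A₀ = 0, so A = 0»: a curl-free bond field with vanishing k-fold average is a gradient `∂φ`, `Q′_kφ = 0`)

statement-level skeleton of published theorems with citation tags; proofs where landed; nothing here is a claim about the Yang–Mills mass gap

PDF held: `paper:balaban1984-cmp95-propagators-rt-i` (journal page = PDF page + 16; text layer, pp. 18, 22, 25, 27, 30 read).

CITATION HEADER (lean-in-tree rule).  Phase-2 proof seat p11 of the mega-formalization `lit-balaban` (HOME
`run/shared/lean/pub/lit-balaban/`), support file of SPARE row **C1.Eq4.4.1-4.4.3** (the Landau-gauge minimizer (4.4.2) of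
[BalabanImbrieJaffe1985] on the V1 calculus, `BalabanImbrieJaffe1984to88.BIJ85LandauMinimizer442V1`): it discharges, on the torus
`T^{(j)}` of `Setup`, the two non-degeneracy inputs displayed as hypotheses in `BIJ85LandauMinimizer442`.  THE PRINTED TEXT, verbatim.
p. 18: *"We identify them with vector valued functions defined on T_ε by the formula A_{⟨x,x+εe_μ⟩} = A(x, x + εe_μ) = A_μ(x),
μ = 1, …, d. (1.1)"*, *"F(p) = (∂A)(p) = ε⁻¹A(∂p) = ε⁻¹(A(x, y) + A(y, z) + A(z, w) + A(w, x)) = (∂_μA_ν)(x) − (∂_νA_μ)(x) (1.2)"*,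
*"A^λ_b = A_b − (∂λ)(b) = A_b − ε⁻¹(λ(b₊) − λ(b₋)) (1.4)"*.  p. 22: *"Now we use spectral properties of the Laplace operator Δ on
the torus T_η. It is a symmetric, non-negative operator, and 0 is its eigenvalue. Constant functions form the eigenspace
corresponding to the eigenvalue 0, and on the subspace orthogonal to constant functions the operator Δ is positive. … Let us
notice further that the operator Q′_k transforms constant functions on the η-lattice into constant functions on the unit
lattice"*.  p. 25: *"the operator Δ is positive definite on N(Q′_k), thus invertible, as it follows from [2]"*.  p. 27: *"(1.57)
It implies that B − Q_kA₀ is orthogonal to constant functions. … we can identify Q_kA₀ = B₀"*.  p. 30: *"Thus if for some A we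
have Δ_aA = 0, then ΔA − dPd*A = 0, QA = 0. (1.72) From the first equation we get A = ∂Δ⁻²Q′*(Q′Δ⁻²Q′*)⁻¹ω + A₀ where A₀ is a
constant vector function and ω is a function on unit lattice T₁ orthogonal to constant functions. Using (1.55) we have QA =
∂₁ω + A₀ = 0, hence ∂₁*∂₁ω = 0, and this implies ω = 0. The above equation implies A₀ = 0, so A = 0 and the positivity
of Δ_a follows."*

WHAT IS TYPED AND PROVED HERE (real bond fields `VecField P j ℝ` and site functions `SiteField P j ℝ` on the torus `T^{(j)}`
of `Setup`, operators `grad c`, `curl c`, `laplace c`, `siteAvgIter k`, `bondAvgIter k` of `LatticeFieldCalculus`, lattice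
factor `c` = (spacing)⁻¹).  §1 the dictionary (1.1)/(1.2)/(1.4) between the V1 calculus and the charted-torus cochain calculus
`TorusChart` (`coch`, `grad_eq_d₀`, `curl_eq_d₁`, `isFlat_of_curl_eq_zero`).  §2 p. 22: `Δλ = 0 ⇒ λ` constant
(`const_of_laplace_eq_zero`), `Q′_k` of a constant is the constant (`siteAvgIter_const`), hence **`Q′_kλ = 0 ∧ Δλ = 0 ⇒ λ = 0`**
(`eq_zero_of_laplace_eq_zero`, the qualitative content of p. 25).  §3 the torus Poincaré lemma in the form of p. 30: a
curl-free bond field is `∂φ + A₀` with `A₀` a constant vector function (`exists_grad_add_dirConst_of_curl_eq_zero`, from the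
structure theorem `TorusChart.eq_d₀_prim_add_seam_wind` — the seam cochain of a winding vector `w` is cohomologous over `ℝ` to
the constant field `w/N`), `Q_kA₀ = A₀` for constant `A₀` ((1.57), `bondAvgIter_dirConst`), and **p. 30's conclusion**: `∂A = 0 ∧
Q_kA = 0 ⇒ A = ∂φ` with `Q′_kφ = 0` (`exists_grad_of_curl_eq_zero_of_bondAvgIter_eq_zero`; the printed «∂₁*∂₁ω = 0 implies ω = 0
… implies A₀ = 0» is read off the windings of `Q_kA = ∂₁(Q′_kφ) + A₀` along the `d` axis loops of `T^{(k)}`).  Carrier clauses (F6):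
standing range `k ≤ m + K` (for (1.20) `B5Eq120IterProof.bondAvgIter_grad`), `c ≠ 0`.  Axioms: the standard three.  Unit
`lit-balaban-p11` (literature-prover-lit-balaban-p11-0).
-/

namespace Literature.MathematicalPhysics.QuantumFieldTheory.Balaban1983to89.B5Positivity172Lattice

open Literature.MathematicalPhysics.QuantumFieldTheory.Balaban1983to89.LatticeFieldCalculus

noncomputable section

variable {P : Params} {j : ℕ}

/-! ## §1 The torus `T^{(j)}` as a charted torus; bond fields as `1`-cochains ((1.1), (1.2), (1.4)) -/

variable (P j) in
/-- the sites of `T^{(j)}` read as the additive group `(ℤ/N)^d`, `N = 2L^{m+K−j}` (the type `Site P j` of `Setup` IS this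
function type; here with its group structure). [cite: Balaban1984PropagatorsI, (1.1) p.18] -/
abbrev TT : Type := Fin P.d → ZMod (P.sitesPerDir j)

variable (P j) in
/-- the isotropic chart of `T^{(j)}`: unit translations `e_μ`, coordinates `x_μ ∈ {0, …, N − 1}`.
[cite: Balaban1984PropagatorsI, (1.1) p.18] -/
abbrev chart : TorusChart (TT P j) P.d := TorusChart.pi P.d (P.sitesPerDir j)

/-- a site as a group element. [cite: Balaban1984PropagatorsI, (1.1) p.18] -/
abbrev toT (x : Site P j) : TT P j := x

/-- a group element as a site. [cite: Balaban1984PropagatorsI, (1.1) p.18] -/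
abbrev ofT (x : TT P j) : Site P j := x

/-- **(1.1)**: a bond field `A_{⟨x,x+e_μ⟩}` read as the vector valued function `A_μ(x)`, i.e. as a `1`-cochain on the charted
torus. [cite: Balaban1984PropagatorsI, (1.1) p.18] -/
def coch (A : VecField P j ℝ) : TT P j → Fin P.d → ℝ := fun x μ => A ⟨ofT x, μ⟩

/-- unfolding `coch`. [cite: Balaban1984PropagatorsI, (1.1) p.18] -/
@[simp] theorem coch_apply (A : VecField P j ℝ) (x : TT P j) (μ : Fin P.d) : coch A x μ = A ⟨ofT x, μ⟩ := rfl

/-- `x + e_μ` of `Setup` is the chart's unit translation. [cite: Balaban1984PropagatorsI, (1.1) p.18] -/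
theorem shift_eq (x : Site P j) (μ : Fin P.d) : x.shift μ = ofT (toT x + (chart P j).gen μ) := by
  funext ν
  simp only [Site.shift, TorusChart.pi_gen, ofT, toT, Pi.add_apply]
  by_cases h : ν = μ
  · subst h
    simp
  · simp [Function.update_of_ne h, Pi.single_eq_of_ne h]

/-- **(1.4)**: the gradient is `c·d₀`: `(∂λ)(⟨x, x+e_μ⟩) = c(λ(x+e_μ) − λ(x))`. [cite: Balaban1984PropagatorsI, (1.4) p.18] -/
theorem grad_eq_d₀ (c : ℝ) (lam : SiteField P j ℝ) (x : Site P j) (μ : Fin P.d) :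
    grad c lam ⟨x, μ⟩ = c * (chart P j).d₀ (fun y => lam (ofT y)) (toT x) μ := by
  simp only [grad, PBond.tgt, shift_eq, TorusChart.d₀_apply, smul_eq_mul, ofT, toT]

/-- **(1.2)**: the plaquette variable is `c·d₁`: `F(p) = c(A(x,y) + A(y,z) + A(z,w) + A(w,x))` for `p = ⟨x, x+e_μ, x+e_μ+e_ν, x+e_ν⟩`.
[cite: Balaban1984PropagatorsI, (1.2) p.18] -/
theorem curl_eq_d₁ (c : ℝ) (A : VecField P j ℝ) (p : Plaq P j) :
    curl c A p = c * (chart P j).d₁ (coch A) (toT p.src) p.μ p.ν := by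
  simp only [curl, shift_eq, TorusChart.d₁_apply, coch_apply, smul_eq_mul, ofT, toT]

/-- a curl-free bond field (`c ≠ 0`) is a FLAT `1`-cochain (all plaquette circulations vanish, in either orientation).
[cite: Balaban1984PropagatorsI, (1.2) p.18] -/
theorem isFlat_of_curl_eq_zero {c : ℝ} (hc : c ≠ 0) {A : VecField P j ℝ} (h : curl c A = 0) :
    (chart P j).IsFlat (coch A) := by
  intro x i k
  rcases lt_trichotomy i k with hik | rfl | hki
  · have hp := congrFun h ⟨ofT x, i, k, hik⟩
    rw [curl_eq_d₁, Pi.zero_apply, mul_eq_zero] at hp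
    exact hp.resolve_left hc
  · exact (chart P j).d₁_self _ _ _
  · have hp := congrFun h ⟨ofT x, k, i, hki⟩
    rw [curl_eq_d₁, Pi.zero_apply, mul_eq_zero] at hp
    rw [(chart P j).d₁_swap (coch A) x k i, hp.resolve_left hc, neg_zero]

/-! ## §2 p. 22: `Δλ = 0 ⇒ λ` constant; `Q′_k` preserves constants; `Δ` is injective on `N(Q′_k)` (p. 25) -/

/-- `Σ_b (∂λ)_b² = Σ_x λ(x)(Δλ)(x)` (summation by parts `LatticeFieldCalculus.sum_grad_mul` + `∂*∂ = Δ`). [folklore] -/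
private theorem sum_grad_sq_eq (c : ℝ) (lam : SiteField P j ℝ) :
    ∑ b : PBond P j, grad c lam b ^ 2 = ∑ x : Site P j, lam x * laplace c lam x := by
  have h := sum_grad_mul c lam (grad c lam)
  rw [diverg_grad] at h
  simpa [sq] using h

/-- **p. 22, AS PRINTED** (*"Constant functions form the eigenspace corresponding to the eigenvalue 0"*), the inclusion
`ker Δ ⊆ constants` on the V1 calculus: `Δλ = 0` (lattice factor `c ≠ 0`) forces `∂λ = 0`, hence `λ` constant (the torus is
connected by unit steps, `TorusChart.d₀_eq_zero_iff`). [cite: Balaban1984PropagatorsI, p.22 (text)] -/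
theorem const_of_laplace_eq_zero {c : ℝ} (hc : c ≠ 0) {lam : SiteField P j ℝ} (h : laplace c lam = 0) (x : Site P j) :
    lam x = lam default := by
  have hsum : ∑ b : PBond P j, grad c lam b ^ 2 = 0 := by
    rw [sum_grad_sq_eq, h]
    simp
  have hgrad : ∀ b : PBond P j, grad c lam b = 0 := fun b =>
    pow_eq_zero_iff (n := 2) (by norm_num) |>.mp
      ((Finset.sum_eq_zero_iff_of_nonneg fun b _ => sq_nonneg (grad c lam b)).mp hsum b (Finset.mem_univ _))
  have hd : (chart P j).d₀ (fun y => lam (ofT y)) = 0 := by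
    funext y μ
    have := hgrad ⟨ofT y, μ⟩
    rw [grad_eq_d₀, mul_eq_zero] at this
    exact this.resolve_left hc
  exact ((chart P j).d₀_eq_zero_iff _).mp hd (toT x)

/-- **p. 22, AS PRINTED** (*"the operator Q′_k transforms constant functions on the η-lattice into constant functions on the unit
lattice"*): `Q′_k` of a constant is that constant (`LatticeFieldCalculus.siteAvg_const`, iterated).
[cite: Balaban1984PropagatorsI, p.22 (text)] -/
theorem siteAvgIter_const (v : ℝ) : ∀ k : ℕ, siteAvgIter (P := P) k (fun _ : Site P 0 => v) = fun _ => v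
  | 0 => rfl
  | k + 1 => by
    rw [B5Eq120IterProof.siteAvgIter_succ, siteAvgIter_const v k]
    funext y
    exact siteAvg_const v y

/-- **p. 25, the qualitative content, PROVED on the V1 calculus** (verbatim: *"the operator Δ is positive definite on N(Q′_k),
thus invertible"*): `Q′_kλ = 0` and `Δλ = 0` (lattice factor `c ≠ 0`) force `λ = 0`. [cite: Balaban1984PropagatorsI, p.25 (text)] -/
theorem eq_zero_of_laplace_eq_zero {c : ℝ} (hc : c ≠ 0) (k : ℕ) {lam : SiteField P 0 ℝ}
    (hQ : siteAvgIter k lam = 0) (hΔ : laplace c lam = 0) : lam = 0 := by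
  have hconst : lam = fun _ => lam default := funext fun x => const_of_laplace_eq_zero hc hΔ x
  rw [hconst] at hQ ⊢
  rw [siteAvgIter_const] at hQ
  have := congrFun hQ default
  simp only [Pi.zero_apply] at this
  funext x
  simpa using this

/-! ## §3 p. 30: curl-free fields are `∂φ + A₀`; `Q_kA₀ = A₀`; `∂A = 0 ∧ Q_kA = 0 ⇒ A = ∂φ`, `Q′_kφ = 0` -/

/-- a *"constant vector function"* `A₀` (p. 30; p. 27 *"A₀ is a constant configuration"*): the bond field with the value `a_μ`
on every bond of direction `μ`. [cite: Balaban1984PropagatorsI, (1.72) p.30] -/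
def dirConst (a : Fin P.d → ℝ) : VecField P j ℝ := fun b => a b.dir

/-- unfolding `dirConst`. [cite: Balaban1984PropagatorsI, (1.72) p.30] -/
@[simp] theorem dirConst_apply (a : Fin P.d → ℝ) (b : PBond P j) : dirConst a b = a b.dir := rfl

/-- a constant `1`-cochain is flat. [folklore] -/
private theorem isFlat_const (b : Fin P.d → ℝ) : (chart P j).IsFlat (fun (_ : TT P j) μ => b μ) := by
  intro x i k
  simp only [TorusChart.d₁_apply]
  ring

/-- the winding of a constant `1`-cochain along the `μ`-th axis loop is `N·b_μ`. [folklore] -/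
private theorem wind_const (b : Fin P.d → ℝ) (μ : Fin P.d) :
    (chart P j).wind (fun (_ : TT P j) ν => b ν) μ = (P.sitesPerDir j : ℝ) * b μ := by
  simp [TorusChart.wind_eq, TorusChart.lineSum, Finset.sum_const, Finset.card_range, nsmul_eq_mul]

/-- over `ℝ` the seam cochain of a tuple `w` is cohomologous to the constant cochain `w/N`: their difference is a gradient.
[folklore] -/
private theorem exists_seam_sub_const_eq_d₀ (w : Fin P.d → ℝ) :
    ∃ g : TT P j → ℝ, (chart P j).seam w - (fun (_ : TT P j) μ => w μ / (P.sitesPerDir j : ℝ)) = (chart P j).d₀ g := by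
  refine ((chart P j).exists_d₀_eq_iff _).mpr ⟨((chart P j).isFlat_seam w).sub (isFlat_const _), ?_⟩
  funext μ
  have hN : (P.sitesPerDir j : ℝ) ≠ 0 := Nat.cast_ne_zero.mpr (P.sitesPerDir_ne_zero j)
  rw [TorusChart.wind_sub, TorusChart.wind_seam, Pi.sub_apply, wind_const, Pi.zero_apply, mul_div_cancel₀ _ hN, sub_self]

/-- **the torus Poincaré lemma in the form of p. 30** (*"A = ∂(…) + A₀ where A₀ is a constant vector function"*): a curl-free
real bond field on `T^{(j)}` (lattice factor `c ≠ 0`) is a gradient plus a constant vector function — from the structure theorem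
for flat cochains `TorusChart.eq_d₀_prim_add_seam_wind` (gradient + seam cochain of the winding vector), the seam cochain being a
gradient plus the constant `w/N` over `ℝ`. [cite: Balaban1984PropagatorsI, (1.72) p.30] -/
theorem exists_grad_add_dirConst_of_curl_eq_zero {c : ℝ} (hc : c ≠ 0) {A : VecField P j ℝ} (h : curl c A = 0) :
    ∃ (φ : SiteField P j ℝ) (a : Fin P.d → ℝ), A = grad c φ + dirConst a := by
  have hflat := isFlat_of_curl_eq_zero hc h
  have hstr := TorusChart.eq_d₀_prim_add_seam_wind hflat
  set w := (chart P j).wind (coch A) with hw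
  obtain ⟨g, hg⟩ := exists_seam_sub_const_eq_d₀ (P := P) (j := j) w
  set f := (chart P j).prim (coch A) with hf
  refine ⟨fun x => c⁻¹ * (f (toT x) + g (toT x)), fun μ => w μ / (P.sitesPerDir j : ℝ), ?_⟩
  funext b
  cases b with
  | mk x μ =>
    have hθ : A ⟨x, μ⟩ = (chart P j).d₀ f (toT x) μ + (chart P j).seam w (toT x) μ := by
      have := congrFun (congrFun hstr (toT x)) μ
      simpa using this
    have hs : (chart P j).seam w (toT x) μ = (chart P j).d₀ g (toT x) μ + w μ / (P.sitesPerDir j : ℝ) := by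
      have := congrFun (congrFun hg (toT x)) μ
      simp only [Pi.sub_apply] at this
      linarith
    rw [Pi.add_apply, dirConst_apply, grad_eq_d₀, hθ, hs]
    simp only [TorusChart.d₀_apply, ofT, toT]
    field_simp
    ring

/-- straight-contour sums of a constant vector function: `A₀([x, x + n e_μ]) = n·a_μ`. [folklore] -/
private theorem segSum_dirConst (a : Fin P.d → ℝ) (x : Site P j) (μ : Fin P.d) (n : ℕ) :
    segSum (dirConst a) x μ n = n * a μ := by
  simp [segSum, runBond, Finset.sum_const, Finset.card_range, nsmul_eq_mul]

/-- **(1.57) p. 27, AS PRINTED** (*"we can identify Q_kA₀ = B₀"* for a constant configuration `A₀`): the bond average of a constant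
vector function is the same constant vector function on the coarse lattice (one step: `L^{−(d+1)}·L^d·L·a_μ = a_μ`).
[cite: Balaban1984PropagatorsI, (1.57) p.27] -/
theorem bondAvg_dirConst (a : Fin P.d → ℝ) : bondAvg (dirConst a : VecField P j ℝ) = (dirConst a : VecField P (j + 1) ℝ) := by
  funext b
  have hL : (P.L : ℝ) ≠ 0 := Nat.cast_ne_zero.mpr P.L_pos.ne'
  simp only [bondAvg, segSum_dirConst, Finset.sum_const, Finset.card_univ, Fintype.card_fun, Fintype.card_fin, nsmul_eq_mul,
    smul_eq_mul, dirConst_apply, Nat.cast_pow]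
  field_simp
  ring

/-- (1.57) iterated: `Q_kA₀ = A₀`. [cite: Balaban1984PropagatorsI, (1.57) p.27] -/
theorem bondAvgIter_dirConst (a : Fin P.d → ℝ) : ∀ k : ℕ, bondAvgIter (P := P) k (dirConst a) = dirConst a
  | 0 => rfl
  | k + 1 => by rw [B5Eq120IterProof.bondAvgIter_succ, bondAvgIter_dirConst a k, bondAvg_dirConst]

/-- additivity of straight-contour sums. [folklore] -/
private theorem segSum_add (A B : VecField P j ℝ) (x : Site P j) (μ : Fin P.d) (n : ℕ) :
    segSum (A + B) x μ n = segSum A x μ n + segSum B x μ n := by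
  simp only [segSum, Pi.add_apply, Finset.sum_add_distrib]

/-- additivity of the bond average. [folklore] -/
private theorem bondAvg_add (A B : VecField P j ℝ) : bondAvg (A + B) = bondAvg A + bondAvg B := by
  funext c; simp only [bondAvg, Pi.add_apply, smul_eq_mul, segSum_add, Finset.sum_add_distrib]; ring

/-- additivity of `Q_k`. [folklore] -/
private theorem bondAvgIter_add : ∀ (k : ℕ) (A B : VecField P 0 ℝ), bondAvgIter k (A + B) = bondAvgIter k A + bondAvgIter k B
  | 0, _, _ => rfl
  | k + 1, A, B => by
    rw [B5Eq120IterProof.bondAvgIter_succ, B5Eq120IterProof.bondAvgIter_succ, B5Eq120IterProof.bondAvgIter_succ,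
      bondAvgIter_add k A B, bondAvg_add]

/-- the site average is subtractive. [folklore] -/
private theorem siteAvg_sub (f g : SiteField P j ℝ) : siteAvg (f - g) = siteAvg f - siteAvg g := by
  funext y; simp only [siteAvg, Pi.sub_apply, smul_eq_mul, Finset.sum_sub_distrib]; ring

/-- `Q′_k` is subtractive. [folklore] -/
private theorem siteAvgIter_sub : ∀ (k : ℕ) (f g : SiteField P 0 ℝ), siteAvgIter k (f - g) = siteAvgIter k f - siteAvgIter k g
  | 0, _, _ => rfl
  | k + 1, f, g => by
    rw [B5Eq120IterProof.siteAvgIter_succ, B5Eq120IterProof.siteAvgIter_succ, B5Eq120IterProof.siteAvgIter_succ,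
      siteAvgIter_sub k f g, siteAvg_sub]

/-- the gradient kills constants and is subtractive: `∂(φ − κ) = ∂φ`. [folklore] -/
private theorem grad_sub_const (c : ℝ) (φ : SiteField P j ℝ) (κ : ℝ) : grad c (φ - fun _ => κ) = grad c φ := by
  funext b; simp [grad]

/-- the winding of (the cochain of) a gradient vanishes: the axis loop closes up. [folklore] -/
private theorem wind_coch_grad (c : ℝ) (ψ : SiteField P j ℝ) : (chart P j).wind (coch (grad c ψ)) = 0 := by
  have h : coch (grad c ψ) = (chart P j).d₀ (fun y => c * ψ (ofT y)) := by
    funext x μ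
    rw [coch_apply, grad_eq_d₀]
    simp only [TorusChart.d₀_apply, ofT, toT]
    ring
  rw [h, TorusChart.wind_d₀]

/-- the winding of a constant vector function along the `μ`-th axis loop of `T^{(j)}` is `N·a_μ`. [folklore] -/
private theorem wind_coch_dirConst (a : Fin P.d → ℝ) (μ : Fin P.d) :
    (chart P j).wind (coch (dirConst a)) μ = (P.sitesPerDir j : ℝ) * a μ := by
  have h : coch (dirConst a : VecField P j ℝ) = fun (_ : TT P j) ν => a ν := by
    funext x ν; rfl
  rw [h, wind_const]

/-- **p. 30 after (1.72), PROVED on the V1 calculus** (verbatim: *"Using (1.55) we have QA = ∂₁ω + A₀ = 0, hence ∂₁*∂₁ω = 0, and this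
implies ω = 0. The above equation implies A₀ = 0, so A = 0"*; here in the form needed for the Landau gauge): in the standing range
`k ≤ m + K` and for `c ≠ 0`, a bond field on `T^{(0)}` with `∂A = 0` and `Q_kA = 0` is a pure gradient `A = ∂φ` of a site function
with `Q′_kφ = 0`.  Printed route: `A = ∂φ₀ + A₀` (`exists_grad_add_dirConst_of_curl_eq_zero`), `Q_kA = ∂_{(k)}Q′_kφ₀ + A₀` ((1.20)/(1.55)
`B5Eq120IterProof.bondAvgIter_grad`, (1.57) `bondAvgIter_dirConst`), the windings along the axis loops of `T^{(k)}` give `A₀ = 0`, then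
`∂_{(k)}Q′_kφ₀ = 0` makes `Q′_kφ₀` a constant `κ` (p. 22), and `φ = φ₀ − κ`. [cite: Balaban1984PropagatorsI, (1.72) p.30] -/
theorem exists_grad_of_curl_eq_zero_of_bondAvgIter_eq_zero {k : ℕ} (hk : k ≤ P.m + P.K) {c : ℝ} (hc : c ≠ 0)
    {A : VecField P 0 ℝ} (hcurl : curl c A = 0) (hQ : bondAvgIter k A = 0) :
    ∃ φ : SiteField P 0 ℝ, siteAvgIter k φ = 0 ∧ A = grad c φ := by
  obtain ⟨φ₀, a, hA⟩ := exists_grad_add_dirConst_of_curl_eq_zero hc hcurl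
  have hL : (P.L : ℝ) ≠ 0 := Nat.cast_ne_zero.mpr P.L_pos.ne'
  have hck : c / (P.L : ℝ) ^ k ≠ 0 := div_ne_zero hc (pow_ne_zero _ hL)
  -- `Q_kA = ∂_{(k)} Q′_kφ₀ + A₀ = 0` on `T^{(k)}`
  have hQk : grad (c / (P.L : ℝ) ^ k) (siteAvgIter k φ₀) + dirConst a = (0 : VecField P k ℝ) := by
    rw [← B5Eq120IterProof.bondAvgIter_grad k hk c φ₀, ← bondAvgIter_dirConst a k, ← bondAvgIter_add, ← hA, hQ]
  -- windings along the axis loops of `T^{(k)}`: `N_k · a_μ = 0`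
  have ha : a = 0 := by
    funext μ
    have hw := congrFun (congrArg (fun B : VecField P k ℝ => (chart P k).wind (coch B)) hQk) μ
    have hsplit : coch (grad (c / (P.L : ℝ) ^ k) (siteAvgIter k φ₀) + dirConst a)
        = coch (grad (c / (P.L : ℝ) ^ k) (siteAvgIter k φ₀)) + coch (dirConst a : VecField P k ℝ) := by
      funext x ν; rfl
    have hzero : coch (0 : VecField P k ℝ) = 0 := by funext x ν; rfl
    rw [hsplit, TorusChart.wind_add, wind_coch_grad, zero_add, wind_coch_dirConst, hzero, TorusChart.wind_zero,
      Pi.zero_apply, mul_eq_zero] at hw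
    exact hw.resolve_left (Nat.cast_ne_zero.mpr (P.sitesPerDir_ne_zero k))
  have hdc : (dirConst a : VecField P k ℝ) = 0 := by funext b; simp [ha]
  rw [hdc, add_zero] at hQk
  -- `∂_{(k)} Q′_kφ₀ = 0`: `Q′_kφ₀` is a constant `κ`
  set ψ := siteAvgIter k φ₀ with hψ
  have hψconst : ∀ y : Site P k, ψ y = ψ default := by
    have hd : (chart P k).d₀ (fun y => ψ (ofT y)) = 0 := by
      funext y μ
      have := congrFun hQk ⟨ofT y, μ⟩
      rw [grad_eq_d₀, Pi.zero_apply, mul_eq_zero] at this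
      exact this.resolve_left hck
    intro y
    exact ((chart P k).d₀_eq_zero_iff _).mp hd (toT y)
  refine ⟨φ₀ - fun _ => ψ default, ?_, ?_⟩
  · rw [siteAvgIter_sub, siteAvgIter_const]
    funext y
    rw [Pi.sub_apply, ← hψ, hψconst y, sub_self, Pi.zero_apply]
  · rw [grad_sub_const, hA, ha]
    funext b
    simp

end

end Literature.MathematicalPhysics.QuantumFieldTheory.Balaban1983to89.B5Positivity172Lattice
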